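import Mathlib
import HarnessLib

/-!
# A holomorphic map sending a half-disc strictly above its centre value has nonzero derivative at the centre

Topic `Literature/Analysis/Complex`. The local fact behind "`f′(a) ≠ 0` at a boundary point `a` of
a straight boundary segment mapped into the boundary line" (used for the normalisation of Poisson
kernels at flat boundary points, e.g. D. Chelkak, S. Smirnov, Adv. Math. 228 (2011), proof of
Thm. 3.13, where `P(x + iy) = y·∂_yP(x) + O(…)` requires the conformal map to be conformal AT the
boundary point):

> **Theorem (`deriv_ne_zero_of_im_lt`).** Let `w` be analytic at `x`, `ν ∈ ℂ`, `ρ > 0`, and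
> suppose `Im w(x + νζ) > Im w(x)` for all `ζ` with `|ζ| < ρ`, `Im ζ > 0`. Then `w′(x) ≠ 0`.

Proof: if `w′(x) = 0` then `g(ζ) = w(x + νζ) - w(x) = ζⁿ h(ζ)` near `0` with `h(0) = c ≠ 0` and
`n ≥ 2` (isolated zeros, Mathlib `AnalyticAt.exists_eventuallyEq_pow_smul_nonzero_iff`); as `θ`
runs over `(0, π)`, `nθ + arg c` sweeps an interval of length `≥ 2π`, so for some such `θ`,
`Im(e^{inθ} c) < 0`, and then `Im g(re^{iθ}) = rⁿ Im(e^{inθ} h(re^{iθ})) < 0` for small `r > 0`,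
contradicting the hypothesis. Everything is proved, [folklore]
(e.g. Pommerenke, *Boundary Behaviour of Conformal Maps* (1992), proof of Prop. 2.? / the
Schwarz reflection discussion; any textbook treatment of conformality at analytic boundary arcs).
-/

noncomputable section

namespace Literature.Analysis.Complex

open _root_.Complex Metric Set Filter
open scoped Topology Real

/-- **An angle in `(0, π)` at which `sin(nθ + a) < 0`**, for `n ≥ 2` and `a ∈ (-π, π]`: the map
`θ ↦ nθ + a` sweeps an open interval of length `nπ ≥ 2π`. [folklore] -/
theorem exists_sin_nat_mul_add_neg {n : ℕ} (hn : 2 ≤ n) {a : ℝ} (ha1 : -π < a) (ha2 : a ≤ π) :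
    ∃ θ : ℝ, 0 < θ ∧ θ < π ∧ Real.sin (n * θ + a) < 0 := by
  have hnr : (2 : ℝ) ≤ n := by exact_mod_cast hn
  have hn0 : (0 : ℝ) < n := by linarith
  -- a target value `t ∈ (a, a + 2π)` with `sin t < 0`
  obtain ⟨t, hta, hta2, hsin⟩ : ∃ t : ℝ, a < t ∧ t < a + 2 * π ∧ Real.sin t < 0 := by
    by_cases h1 : a < -(π / 2)
    · refine ⟨-(π / 2), h1, by linarith [Real.pi_pos], ?_⟩
      rw [Real.sin_neg, Real.sin_pi_div_two]; norm_num
    · push Not at h1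
      by_cases h2 : a = -(π / 2)
      · refine ⟨5 * π / 4, by rw [h2]; linarith [Real.pi_pos], by rw [h2]; linarith [Real.pi_pos], ?_⟩
        have : Real.sin (5 * π / 4) = -(Real.sqrt 2 / 2) := by
          have h := Real.sin_add_pi (π / 4)
          rw [Real.sin_pi_div_four] at h
          rw [show 5 * π / 4 = π / 4 + π by ring, h]
        rw [this]
        have : 0 < Real.sqrt 2 := Real.sqrt_pos.2 (by norm_num)
        linarith
      · have h3 : -(π / 2) < a := lt_of_le_of_ne h1 (Ne.symm h2)
        refine ⟨3 * π / 2, by linarith [Real.pi_pos], by linarith, ?_⟩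
        have : Real.sin (3 * π / 2) = -1 := by
          rw [show 3 * π / 2 = π / 2 + π by ring, Real.sin_add_pi, Real.sin_pi_div_two]
        rw [this]; norm_num
  refine ⟨(t - a) / n, div_pos (by linarith) hn0, ?_, ?_⟩
  · rw [div_lt_iff₀ hn0]
    nlinarith [Real.pi_pos]
  · have : (n : ℝ) * ((t - a) / n) + a = t := by field_simp; ring
    rw [this]; exact hsin

/-- **Nonzero derivative at the centre of a half-disc mapped strictly upwards** (normalised form,
direction `ν = 1`): if `w` is analytic at `x` and `Im w(x + ζ) > Im w(x)` whenever `|ζ| < ρ`,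
`Im ζ > 0`, then `w′(x) ≠ 0`. [folklore] -/
theorem deriv_ne_zero_of_im_lt_one {w : ℂ → ℂ} {x : ℂ} (hw : AnalyticAt ℂ w x) {ρ : ℝ} (hρ : 0 < ρ)
    (him : ∀ ζ : ℂ, ‖ζ‖ < ρ → 0 < ζ.im → (w x).im < (w (x + ζ)).im) : deriv w x ≠ 0 := by
  intro hd
  -- `g ζ = w (x + ζ) - w x`
  set g : ℂ → ℂ := fun ζ => w (x + ζ) - w x with hg
  have hga : AnalyticAt ℂ g 0 := by
    have h1 : AnalyticAt ℂ (fun ζ : ℂ => x + ζ) 0 := analyticAt_const.add analyticAt_id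
    exact (hw.comp_of_eq h1 (by simp)).sub analyticAt_const
  have hg0 : g 0 = 0 := by simp [hg]
  have hgpos : ∀ ζ : ℂ, ‖ζ‖ < ρ → 0 < ζ.im → 0 < (g ζ).im := by
    intro ζ h1 h2
    have := him ζ h1 h2
    simp only [hg, sub_im]; linarith
  -- `g` has derivative `deriv w x = 0` at `0`
  have hgd : HasDerivAt g (deriv w x) 0 := by
    have h1 : HasDerivAt (fun ζ : ℂ => x + ζ) 1 0 := by
      simpa using (hasDerivAt_id (0 : ℂ)).const_add x
    have h2 : HasDerivAt w (deriv w x) ((fun ζ : ℂ => x + ζ) 0) := by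
      simpa using hw.differentiableAt.hasDerivAt
    have := (h2.comp 0 h1).sub_const (w x)
    simpa [hg] using this
  rw [hd] at hgd
  -- `g` is not identically zero near `0`
  have hne : ¬ ∀ᶠ ζ in 𝓝 (0 : ℂ), g ζ = 0 := by
    intro hev
    obtain ⟨ε, hε, hball⟩ := Metric.eventually_nhds_iff_ball.1 hev
    set ζ : ℂ := ((min ε ρ / 2 : ℝ) : ℂ) * I with hζ
    have hm : 0 < min ε ρ / 2 := by positivity
    have hζn : ‖ζ‖ = min ε ρ / 2 := by
      rw [hζ, norm_mul, norm_real, norm_I, mul_one, Real.norm_eq_abs, abs_of_pos hm]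
    have h1 : ζ ∈ ball (0 : ℂ) ε := by
      rw [mem_ball, dist_zero_right, hζn]; linarith [min_le_left ε ρ]
    have h2 : ‖ζ‖ < ρ := by rw [hζn]; linarith [min_le_right ε ρ]
    have h3 : 0 < ζ.im := by simp [hζ, hm]
    have := hgpos ζ h2 h3
    rw [hball ζ h1] at this
    simp at this
  -- factorisation `g = ζ^n h`, `h 0 ≠ 0`
  obtain ⟨n, h, hha, hh0, hfac⟩ := hga.exists_eventuallyEq_pow_smul_nonzero_iff.2 hne
  simp only [sub_zero] at hfac
  -- `n ≥ 2`
  have hn1 : n ≠ 0 := by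
    rintro rfl
    have := hfac.self_of_nhds
    rw [hg0, pow_zero, one_smul] at this
    exact hh0 this.symm
  have hn2 : n ≠ 1 := by
    rintro rfl
    have hd1 : HasDerivAt (fun ζ : ℂ => ζ ^ 1 • h ζ) (h 0) 0 := by
      have h1 : HasDerivAt (fun ζ : ℂ => ζ * h ζ) (1 * h 0 + 0 * deriv h 0) 0 :=
        (hasDerivAt_id 0).mul hha.differentiableAt.hasDerivAt
      simp only [one_mul, zero_mul, add_zero] at h1
      refine h1.congr_of_eventuallyEq (Eventually.of_forall fun ζ => ?_)
      simp [smul_eq_mul]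
    have hd2 : HasDerivAt g (h 0) 0 := hd1.congr_of_eventuallyEq hfac
    exact hh0 (hd2.unique hgd)
  have hn : 2 ≤ n := by omega
  -- the bad angle
  set c := h 0 with hc
  obtain ⟨θ, hθ0, hθπ, hsin⟩ := exists_sin_nat_mul_add_neg hn (neg_pi_lt_arg c) (arg_le_pi c)
  set u : ℂ := exp (θ * I) with hu
  have hun : ‖u‖ = 1 := by rw [hu]; exact norm_exp_ofReal_mul_I θ
  -- `Im (uⁿ c) < 0`
  have hneg : (u ^ n * c).im < 0 := by
    have h1 : u ^ n * c = (‖c‖ : ℂ) * exp (((n * θ + arg c : ℝ) : ℂ) * I) := by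
      rw [hu, ← Complex.exp_nat_mul]
      conv_lhs => rw [← norm_mul_exp_arg_mul_I c]
      rw [mul_left_comm, ← Complex.exp_add]
      congr 2
      push_cast; ring
    rw [h1, mul_comm, Complex.im_mul_ofReal, exp_ofReal_mul_I_im]
    exact mul_neg_of_neg_of_pos hsin (norm_pos_iff.2 hh0)
  -- `h (r u) → c` as `r → 0⁺`
  have hlim : Tendsto (fun r : ℝ => (u ^ n * h ((r : ℂ) * u)).im) (𝓝[>] 0) (𝓝 ((u ^ n * c).im)) := by
    have h1 : Tendsto (fun r : ℝ => (r : ℂ) * u) (𝓝[>] 0) (𝓝 0) := by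
      have : Tendsto (fun r : ℝ => (r : ℂ) * u) (𝓝 0) (𝓝 ((0 : ℝ) * u)) :=
        ((continuous_ofReal.tendsto 0).mul tendsto_const_nhds)
      rw [ofReal_zero, zero_mul] at this
      exact this.mono_left nhdsWithin_le_nhds
    have h2 : Tendsto (fun r : ℝ => h ((r : ℂ) * u)) (𝓝[>] 0) (𝓝 c) :=
      (hha.continuousAt.tendsto).comp h1
    exact (continuous_im.tendsto _).comp (tendsto_const_nhds.mul h2)
  -- eventually (small `r > 0`): the factorisation holds at `r u`, `r < ρ`, and the imaginary part is negative
  obtain ⟨ε, hε, hball⟩ := Metric.eventually_nhds_iff_ball.1 hfac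
  have hev1 : ∀ᶠ r : ℝ in 𝓝[>] 0, (u ^ n * h ((r : ℂ) * u)).im < 0 :=
    hlim (Iio_mem_nhds hneg)
  have hev2 : ∀ᶠ r : ℝ in 𝓝[>] 0, r < min ε ρ :=
    nhdsWithin_le_nhds (Iio_mem_nhds (lt_min hε hρ))
  have hev3 : ∀ᶠ r : ℝ in 𝓝[>] 0, 0 < r := eventually_nhdsWithin_of_forall fun r hr => hr
  obtain ⟨r, hr1, hr2, hr3⟩ := (hev1.and (hev2.and hev3)).exists
  have hrε : r < ε := lt_of_lt_of_le hr2 (min_le_left _ _)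
  have hrρ : r < ρ := lt_of_lt_of_le hr2 (min_le_right _ _)
  set ζ : ℂ := (r : ℂ) * u with hζ
  have hζn : ‖ζ‖ = r := by rw [hζ, norm_mul, norm_real, hun, mul_one, Real.norm_eq_abs, abs_of_pos hr3]
  have hζim : 0 < ζ.im := by
    rw [hζ, hu, mul_comm, Complex.im_mul_ofReal, exp_ofReal_mul_I_im]
    exact mul_pos (Real.sin_pos_of_pos_of_lt_pi hθ0 hθπ) hr3
  have hgζ : g ζ = ζ ^ n • h ζ := hball ζ (by rw [mem_ball, dist_zero_right, hζn]; exact hrε)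
  have him_neg : (g ζ).im < 0 := by
    rw [hgζ, smul_eq_mul, hζ, mul_pow, mul_assoc, ← ofReal_pow, mul_comm, Complex.im_mul_ofReal]
    exact mul_neg_of_neg_of_pos hr1 (pow_pos hr3 n)
  have := hgpos ζ (by rw [hζn]; exact hrρ) hζim
  linarith

/-- **Nonzero derivative at the centre of a half-disc mapped strictly upwards**: if `w` is analytic
at `x` and `Im w(x + νζ) > Im w(x)` whenever `|ζ| < ρ`, `Im ζ > 0` (i.e. `w` maps the open
half-disc `x + ν·{|ζ| < ρ, Im ζ > 0}` strictly above the level `Im w(x)`; the direction `ν` is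
any complex number, `ν = ±1, ±i` for axis-parallel half-discs — for `ν = 0` the hypothesis is
contradictory), then `w′(x) ≠ 0`. [folklore] -/
theorem deriv_ne_zero_of_im_lt {w : ℂ → ℂ} {x : ℂ} (ν : ℂ) (hw : AnalyticAt ℂ w x) {ρ : ℝ}
    (hρ : 0 < ρ) (him : ∀ ζ : ℂ, ‖ζ‖ < ρ → 0 < ζ.im → (w x).im < (w (x + ν * ζ)).im) :
    deriv w x ≠ 0 := by
  -- `W z = w (x + ν (z - x))`
  set W : ℂ → ℂ := fun z => w (x + ν * (z - x)) with hW
  have haff : AnalyticAt ℂ (fun z : ℂ => x + ν * (z - x)) x :=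
    analyticAt_const.add (analyticAt_const.mul (analyticAt_id.sub analyticAt_const))
  have hWa : AnalyticAt ℂ W x := hw.comp_of_eq haff (by simp)
  have hWx : W x = w x := by simp [hW]
  have hWd : HasDerivAt W (deriv w x * ν) x := by
    have h1 : HasDerivAt (fun z : ℂ => x + ν * (z - x)) (ν * 1) x := by
      have := ((hasDerivAt_id x).sub_const x).const_mul ν
      simpa using this.const_add x
    rw [mul_one] at h1
    have h2 : HasDerivAt w (deriv w x) ((fun z : ℂ => x + ν * (z - x)) x) := by
      simpa using hw.differentiableAt.hasDerivAt
    exact h2.comp x h1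
  have hne := deriv_ne_zero_of_im_lt_one hWa hρ (fun ζ h1 h2 => by
    have := him ζ h1 h2
    simpa [hW] using this)
  rw [hWd.deriv] at hne
  intro h0
  rw [h0, zero_mul] at hne
  exact hne rfl

end Literature.Analysis.Complex
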